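import Mathlib
import Summits.ValiantsHypothesis.ValiantsHypothesis.Theorems.ValuativeGCTValuativeFlipPencilJacobian
import Summits.ValiantsHypothesis.ValiantsHypothesis.Theorems.ValuativeGCTValuativeFlipTwoRowNoFlip
import Literature.AlgebraicGeometry.DeterminantalHypersurfaces.KernerVinnikovSaturation

/-!
# Ternary forms are border-determinantal (algebraic route): every ternary form of degree `m`
# lies in `Δ(det_m)`, and `H(3)` of the few-row table is discharged

Crux `ValuativeGCT.ValuativeFlip` (stmt-ValiantsHypothesis-12624), wall-breaker axis D
("det-orbit-closure multiplicity bounds for detCensus", seat k3 gen 1), fourth file of the chain,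
over `ValuativeGCTValuativeFlipPencilJacobian` (density of determinantal ternary forms as algebraic
independence) and `ValuativeGCTValuativeFlipTwoRowNoFlip` (the conditional row-`k` no-go
`noFlip_of_topForms_mem_orbitClosure`, wall-breaker k14).

* `aeval_mem_orbitClosure_detFormLex_of_isHomogeneous` — EVERY TERNARY FORM OF DEGREE `m` LIES IN
  `Δ(det_m)` (in any three letters of the `m × m` matrix): a test polynomial vanishing on
  `GL · det_m` vanishes on `End · det_m`, hence at every determinantal ternary form; pulled back
  to ternary coefficient vectors it is a polynomial vanishing at the values of the algebraically
  independent coefficient polynomials of the generic pencil, hence zero.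
* `mem_orbitClosure_detFormLex_of_vars_subset_range_three` — the same for forms whose variables
  lie among three letters.
* `topForms_three_mem_orbitClosure_detFormLex` — the hypothesis `H(3)` of
  `noFlip_of_topForms_mem_orbitClosure`, DISCHARGED (registered stub of this seat).
* `orbitMultiplicity_paddedPer_le_det_of_card_parts_le_three` —
  `mult_{λ*} ℂ[Δ_m(X₀₀^{m-n} per_n)] ≤ K_m(λ*)` for `ℓ(λ) ≤ 3` at EVERY padding `n ≤ m`.

Concurrency note.  The same border statement was landed minutes earlier by wall-breaker k14 gen 1
through an ANALYTIC route (`ValuativeGCTValuativeFlipTridiagonalSubmersion`: tridiagonal Toeplitz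
pencil, inverse function theorem, identity theorem), together with the corollaries
`linSubst_three_letters_mem_orbitClosure_detFormLex`, `noValuativeFlip_of_card_parts_le_three`
(no valuative flip on `≤ 3`-row shapes), `four_le_card_parts_of_valuativeFlip` and
`det_orbitMultiplicity_eq_plethysmCoeffOfPartition_of_card_parts_le_three` (`K_m(λ*) = a_λ(δ[m])`
for `ℓ(λ) ≤ 3`); those are NOT restated here (import that module for them).  The present chain
is the ALGEBRAIC route: it needs no analysis, works over every field of characteristic zero at the
level of `algebraicIndependent_coeff_det_ternaryPencil`, and closes this seat's registered stub.
Either file closes item D3 of the siege decomposition (DECOMPOSITIONS.md §1, axis D): rows `≤ 3`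
of the few-row table are equation-free on the determinant side and carry no valuative flip; the
four-row count of line `four-row-count` is the first live case.

References: L. E. Dickson, Trans. AMS 22 (1921) 167–179; A. Beauville, Michigan Math. J. 48 (2000)
§4; BLMW, SIAM J. Comput. 40 (2011) §5.3; J. M. Landsberg, *Geometry and Complexity Theory* (2017)
§6.8, §8.4.
-/

-- `Summit.ValiantsHypothesis.ValiantsHypothesis.…` is the tree's mandated single-conjunct layout (Sub = Summit).
set_option linter.dupNamespace false

namespace Summit.ValiantsHypothesis.ValiantsHypothesis.Theorems.ValuativeFlip

open scoped BigOperators Matrix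
open Finset
open Fin.CommRing  -- same elaboration context as the previous files of the chain (cyclic index arithmetic)

noncomputable section

/-! ## From algebraic independence to the orbit closure: every ternary form lies in `Δ(det_m)` -/

section Density

open MvPolynomial
open Literature.NumberTheory.DiophantineGeometry Literature.Computability.AlgebraicComplexity

/-- A form of degree `m` is the sum of its degree-`m` monomials: `f = Σ_e coeff_e f · x^e` over
`e ∈ degMonomials`. [folklore] -/
theorem sum_coeff_smul_monomial_of_isHomogeneous {σ : Type*} [Fintype σ] [DecidableEq σ] {m : ℕ}
    {f : MvPolynomial σ ℂ} (hf : f.IsHomogeneous m) :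
    ∑ e : DegIdx σ m, coeff e.1 f • (monomial e.1 (1 : ℂ)) = f := by
  classical
  rw [Finset.sum_coe_sort (degMonomials σ m) (fun d => coeff d f • monomial d (1 : ℂ))]
  have hsub : f.support ⊆ degMonomials σ m := by
    intro d hd
    rw [mem_degMonomials_iff, Finsupp.degree_eq_weight_one]
    exact hf (mem_support_iff.mp hd)
  rw [← Finset.sum_subset hsub]
  · conv_rhs => rw [f.as_sum]
    refine Finset.sum_congr rfl fun d _ => ?_
    rw [smul_eq_C_mul, C_mul_monomial, mul_one]
  · intro d _ hd
    rw [notMem_support_iff.mp hd, zero_smul]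

variable {n : ℕ}

/-- The determinantal ternary form `det (Σ_t A^{(t)} x_t)`, written in three letters `a t` of the
matrix, is a linear substitution of `det_m` (an element of `End · det_m`). [folklore] -/
theorem linSubst_detFormLex_eq_aeval_det (a : Fin 3 → MatIdx (n + 1))
    (A : Fin 3 × Fin (n + 1) × Fin (n + 1) → ℂ) :
    linSubst (MatIdx (n + 1)) ℂ (Matrix.of fun l p : MatIdx (n + 1) =>
        ∑ t : Fin 3, if l = a t then A (t, (ofLex p).1, (ofLex p).2) else 0) (detFormLex ℂ (n + 1)) =
      aeval (fun t => (X (a t) : MvPolynomial (MatIdx (n + 1)) ℂ))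
        (Matrix.of fun i j : Fin (n + 1) =>
          ∑ t : Fin 3, (X t : MvPolynomial (Fin 3) ℂ) * C (A (t, i, j))).det := by
  classical
  rw [CutBites.Negative.detFormLex_eq_det_of, AlgHom.map_det, AlgHom.map_det]
  congr 1
  refine Matrix.ext fun i j => ?_
  simp only [AlgHom.mapMatrix_apply, Matrix.map_apply, Matrix.of_apply, linSubst_X, map_sum,
    map_mul, aeval_X, aeval_C, algebraMap_eq, ofLex_toLex, Finset.sum_smul, ite_smul, zero_smul]
  rw [Finset.sum_comm]
  refine Finset.sum_congr rfl fun t _ => ?_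
  rw [Finset.sum_ite_eq' Finset.univ (a t), if_pos (Finset.mem_univ _), smul_eq_C_mul, mul_comm]

/-- Determinantal ternary forms are forms of degree `m` (determinant of linear forms,
`isHomogeneous_det_of_linear`). [folklore] -/
theorem isHomogeneous_det_ternaryPencil (A : Fin 3 × Fin (n + 1) × Fin (n + 1) → ℂ) :
    (Matrix.of fun i j : Fin (n + 1) =>
      ∑ t : Fin 3, (X t : MvPolynomial (Fin 3) ℂ) * C (A (t, i, j))).det.IsHomogeneous (n + 1) := by
  have h := Literature.AlgebraicGeometry.DeterminantalHypersurfaces.isHomogeneous_det_of_linear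
    (X := Matrix.of fun i j : Fin (n + 1) => ∑ t : Fin 3, (X t : MvPolynomial (Fin 3) ℂ) *
      C (A (t, i, j))) fun i j => ?_
  · simpa using h
  · rw [Matrix.of_apply]
    refine IsHomogeneous.sum _ _ _ fun t _ => ?_
    simpa using (isHomogeneous_X ℂ t).mul (isHomogeneous_C (Fin 3) (A (t, i, j)))

/-- The test polynomial `P` on `Sym^m ℂ^{m²}`, pulled back to the ternary coefficient vectors
`c ↦ Σ_e c_e x^e ↦ (its push-forward to the letters `ψ`)`, evaluates as `P` at that push-forward.
[folklore] -/
theorem eval_aeval_ternaryCoeffPoly (ψ : Fin 3 → MvPolynomial (MatIdx (n + 1)) ℂ)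
    (P : MvPolynomial ((MatIdx (n + 1)) →₀ ℕ) ℂ) (c : DegIdx (Fin 3) (n + 1) → ℂ) :
    eval c (aeval (fun d : (MatIdx (n + 1)) →₀ ℕ => ∑ e : DegIdx (Fin 3) (n + 1),
        C (coeff d (aeval ψ (monomial e.1 (1 : ℂ)))) * X e) P) =
      aeval (coeffVec (aeval ψ (∑ e : DegIdx (Fin 3) (n + 1), c e • monomial e.1 (1 : ℂ)))) P := by
  rw [eval_aeval_eq_aeval]
  have hfun : (fun d : (MatIdx (n + 1)) →₀ ℕ => eval c (∑ e : DegIdx (Fin 3) (n + 1),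
      C (coeff d (aeval ψ (monomial e.1 (1 : ℂ)))) * X e)) =
      coeffVec (aeval ψ (∑ e : DegIdx (Fin 3) (n + 1), c e • monomial e.1 (1 : ℂ))) := by
    funext d
    rw [coeffVec_apply, map_sum, map_sum, coeff_sum]
    refine Finset.sum_congr rfl fun e _ => ?_
    rw [map_mul, eval_C, eval_X, smul_eq_C_mul, map_mul, aeval_C, algebraMap_eq, coeff_C_mul,
      mul_comm]
  rw [hfun]

/-- **Every ternary form of degree `m` lies in `Δ(det_m)`** (three arbitrary letters `a t` of the
`m × m` matrix, `m = n + 1`).  A test polynomial `P` vanishing on `GL · det_m` vanishes on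
`End · det_m` (`endOrbit_subset_orbitClosure_holds`), in particular at every determinantal ternary
form `det (Σ_t A^{(t)} x_t)` written in the letters `a t`; composed with the (linear) map from
ternary coefficient vectors to matrix-coefficient vectors, `P` becomes a polynomial `Ψ` in the
ternary coefficients that vanishes at the coefficient vector of every determinantal form, i.e.
`Ψ(G) = 0` pointwise for the algebraically independent coefficient polynomials `G` of
`algebraicIndependent_coeff_det_ternaryPencil`; so `Ψ = 0` and `P` vanishes at every ternary form.
This is where (the density half of) Dickson's theorem enters GCT's few-row table: row 3 of the
table is equation-free. [folklore, over Dickson 1921] -/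
theorem aeval_mem_orbitClosure_detFormLex_of_isHomogeneous (a : Fin 3 → MatIdx (n + 1))
    (q : MvPolynomial (Fin 3) ℂ) (hq : q.IsHomogeneous (n + 1)) :
    aeval (fun t => (X (a t) : MvPolynomial (MatIdx (n + 1)) ℂ)) q ∈
      orbitClosure (detFormLex ℂ (n + 1)) := by
  classical
  rw [mem_orbitClosure_iff]
  intro P hP
  -- `P` vanishes on `End · det`
  have hEnd : ∀ B : Matrix (MatIdx (n + 1)) (MatIdx (n + 1)) ℂ,
      aeval (coeffVec (linSubst (MatIdx (n + 1)) ℂ B (detFormLex ℂ (n + 1)))) P = 0 := fun B =>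
    (mem_orbitClosure_iff.mp (endOrbit_subset_orbitClosure_holds _ ⟨B, rfl⟩)) P hP
  -- the test polynomial as a polynomial `Ψ` in the ternary coefficients
  set Ψ : MvPolynomial (DegIdx (Fin 3) (n + 1)) ℂ := aeval (fun d : (MatIdx (n + 1)) →₀ ℕ =>
    ∑ e : DegIdx (Fin 3) (n + 1), C (coeff d (aeval (fun t => (X (a t) : MvPolynomial (MatIdx (n + 1)) ℂ))
      (monomial e.1 (1 : ℂ)))) * X e) P with hΨ
  -- `Ψ` vanishes at the coefficient vector of every determinantal form ...
  have hD : ∀ A : Fin 3 × Fin (n + 1) × Fin (n + 1) → ℂ,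
      eval (fun e : DegIdx (Fin 3) (n + 1) => coeff e.1 (Matrix.of fun i j : Fin (n + 1) =>
        ∑ t : Fin 3, (X t : MvPolynomial (Fin 3) ℂ) * C (A (t, i, j))).det) Ψ = 0 := by
    intro A
    rw [hΨ, eval_aeval_ternaryCoeffPoly,
      sum_coeff_smul_monomial_of_isHomogeneous (isHomogeneous_det_ternaryPencil A),
      ← linSubst_detFormLex_eq_aeval_det a A]
    exact hEnd _
  -- ... i.e. at the values of the algebraically independent coefficient polynomials: `Ψ = 0`
  have hΨ0 : Ψ = 0 := by
    refine (algebraicIndependent_iff.mp (algebraicIndependent_coeff_det_ternaryPencil (K := ℂ) n))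
      Ψ (MvPolynomial.funext fun A => ?_)
    rw [map_zero, eval_aeval_eq_aeval]
    have hG : (fun e : DegIdx (Fin 3) (n + 1) => eval A (coeff e.1 (sumAlgEquiv ℂ (Fin 3)
        (Fin 3 × Fin (n + 1) × Fin (n + 1)) (Matrix.of fun i j : Fin (n + 1) => ∑ t : Fin 3,
          (X (Sum.inl t) : MvPolynomial (Fin 3 ⊕ (Fin 3 × Fin (n + 1) × Fin (n + 1))) ℂ) *
            X (Sum.inr (t, i, j))).det))) =
        fun e : DegIdx (Fin 3) (n + 1) => coeff e.1 (Matrix.of fun i j : Fin (n + 1) =>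
          ∑ t : Fin 3, (X t : MvPolynomial (Fin 3) ℂ) * C (A (t, i, j))).det :=
      funext fun e => eval_coeff_det_genPencil A e.1
    rw [hG, MvPolynomial.aeval_eq_eval]
    exact hD A
  -- conclusion: `P` vanishes at `q`, a point of `Sym^m ℂ³`
  rw [← sum_coeff_smul_monomial_of_isHomogeneous hq, ← eval_aeval_ternaryCoeffPoly, ← hΨ, hΨ0,
    map_zero]

/-- **Forms of degree `m` in three letters are border-determinantal.** A homogeneous polynomial of
degree `m ≥ 1` in the matrix variables `MatIdx m` all of whose variables are among three letters
`a 0, a 1, a 2` lies in `Δ(det_m)`. [folklore, over Dickson 1921] -/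
theorem mem_orbitClosure_detFormLex_of_vars_subset_range_three {m : ℕ} [NeZero m]
    (a : Fin 3 → MatIdx m) {q : MvPolynomial (MatIdx m) ℂ} (hq : q.IsHomogeneous m)
    (hvars : ↑q.vars ⊆ Set.range a) : q ∈ orbitClosure (detFormLex ℂ m) := by
  classical
  obtain ⟨n, rfl⟩ : ∃ n, m = n + 1 := ⟨m - 1, by have := NeZero.pos m; omega⟩
  -- pull back to three variables
  let φ : MatIdx (n + 1) → MvPolynomial (Fin 3) ℂ := fun l =>
    if h : l ∈ Set.range a then X (Classical.choose h) else 0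
  set q₃ : MvPolynomial (Fin 3) ℂ := aeval φ q with hq₃
  have hφ : ∀ l, (φ l).IsHomogeneous 1 := by
    intro l
    simp only [φ]
    split_ifs
    · exact isHomogeneous_X ℂ _
    · exact isHomogeneous_zero _ _ _
  have hq₃hom : q₃.IsHomogeneous (n + 1) := by simpa only [one_mul] using hq.aeval φ hφ
  have hback : aeval (fun t => (X (a t) : MvPolynomial (MatIdx (n + 1)) ℂ)) q₃ = q := by
    rw [hq₃, ← AlgHom.comp_apply, comp_aeval]
    conv_rhs => rw [← aeval_X_left_apply (R := ℂ) q]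
    refine hom_congr_vars (by ext; simp) (fun l hl _ => ?_) rfl
    have hl' : l ∈ Set.range a := hvars (Finset.mem_coe.mpr hl)
    simp only [AlgHom.toRingHom_eq_coe, RingHom.coe_coe, aeval_X, φ, dif_pos hl']
    rw [Classical.choose_spec hl']
  rw [← hback]
  exact aeval_mem_orbitClosure_detFormLex_of_isHomogeneous a q₃ hq₃hom

/-- **Hypothesis `H(3)` of `noFlip_of_topForms_mem_orbitClosure`, discharged.** For `m ≥ 1`, every
form of degree `m` in the three greatest lexicographic letters of `MatIdx m` (the letters `i` with
`m² ≤ idx(i) + 3`) lies in `Δ(det_m)`. [folklore, over Dickson 1921] -/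
theorem topForms_three_mem_orbitClosure_detFormLex (m : ℕ) [NeZero m]
    (q : MvPolynomial (MatIdx m) ℂ) (hq : q.IsHomogeneous m)
    (hvars : ∀ i ∈ q.vars, m * m ≤ (((matIdxEquiv m).symm i : Fin (m * m)) : ℕ) + 3) :
    q ∈ orbitClosure (detFormLex ℂ m) := by
  classical
  have hmm : 0 < m * m := Nat.mul_pos (NeZero.pos m) (NeZero.pos m)
  let a : Fin 3 → MatIdx m := fun t => matIdxEquiv m ⟨m * m - 1 - t, by omega⟩
  refine mem_orbitClosure_detFormLex_of_vars_subset_range_three a hq fun i hi => ?_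
  have h := hvars i (Finset.mem_coe.mp hi)
  refine ⟨⟨m * m - 1 - ((matIdxEquiv m).symm i : ℕ), by omega⟩, ?_⟩
  simp only [a]
  conv_rhs => rw [← (matIdxEquiv m).apply_symm_apply i]
  congr 1
  exact Fin.ext (by simp; omega)

end Density

/-! ## Row 3 of the few-row table: the multiplicity inequality on shapes with at most three rows -/

section ThreeRows

open MvPolynomial
open Literature.NumberTheory.DiophantineGeometry Literature.Computability.AlgebraicComplexity

/-- **No multiplicity obstruction on shapes with at most three rows, at any padding.** For `n ≤ m`
and `λ ⊢ mδ` with `ℓ(λ) ≤ 3`: `mult_{λ*} ℂ[Δ_m(X₀₀^{m-n} per_n)] ≤ K_m(λ*)`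
(`orbitMultiplicity_paddedPer_le_det_of_topForms_mem_orbitClosure` at `k = 3` with `H(3)`
discharged by `topForms_three_mem_orbitClosure_detFormLex`). -/
theorem orbitMultiplicity_paddedPer_le_det_of_card_parts_le_three {n m : ℕ} [NeZero m]
    (hnm : n ≤ m) {δ : ℕ} (lam : Nat.Partition (m * δ)) (h3 : lam.parts.card ≤ 3) :
    orbitMultiplicity ℂ (paddedPerFormLex ℂ n m) m (Weight.dualOfPartition (m * m) lam).toMatIdx ≤
      orbitMultiplicity ℂ (detFormLex ℂ m) m (Weight.dualOfPartition (m * m) lam).toMatIdx := by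
  refine orbitMultiplicity_paddedPer_le_det_of_topForms_mem_orbitClosure hnm 3
    (topForms_three_mem_orbitClosure_detFormLex m) _ fun i hi => ?_
  obtain ⟨i', rfl⟩ : ∃ i' : Fin (m * m), matIdxEquiv m i' = i :=
    ⟨(matIdxEquiv m).symm i, (matIdxEquiv m).apply_symm_apply i⟩
  refine NoValuativeFlip.dualOfPartition_toMatIdx_eq_zero_of_lt lam i' ?_
  simp only [OrderIso.symm_apply_apply] at hi
  omega

end ThreeRows

end

end Summit.ValiantsHypothesis.ValiantsHypothesis.Theorems.ValuativeFlip
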